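import Literature.Analysis.FluidPDE.HardSphereFlowJointMeasurable
import HarnessLib

/-!
# Measurability in time of a hard-sphere trajectory

A hard-sphere trajectory `γ : ℝ → Config N d X` (`Kinetic.IsHardSphereTrajectory`) is not
continuous — the velocities jump at the collision times — but it is right-continuous
(`IsHardSphereTrajectory.tendsto_nhdsGT`), hence Borel measurable: `γ s` is the limit of
`γ (d_n(s))` along the dyadic grid points `d_n(s) ↓ s` to the right of `s`
(`HardSphereFlow.tendsto_dyadicUpper` of `HardSphereFlowJointMeasurable`), and each approximant
factors through the countable-valued measurable index `⌊2ⁿ s⌋`. This is the single-trajectory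
counterpart of `HardSphereFlow.measurable_flow_prod` and is what makes time-pushforwards of a
trajectory (occupation measures, the particle part `Σ_p (1, v_p) ⊗ (1, v_p) dt|_{γ(p)}` of Serre's
mass–momentum tensor as a matrix-valued measure) well defined.

* `IsHardSphereTrajectory.measurable` — `Measurable γ` (metrizable second-countable Borel
  position space, continuous translations: `ℝ^d`, `T^d`);
* `IsHardSphereTrajectory.measurable_pos`, `measurable_vel` — coordinates;
* `IsHardSphereTrajectory.measurable_torus` — the torus instance.

## References

* I. Gallagher, L. Saint-Raymond, B. Texier, *From Newton to Boltzmann* (2013), §4.1–4.2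
  (trajectories are piecewise free flight, right-continuous at collisions). [folklore]
-/

open Set Filter Function MeasureTheory
open scoped Topology

namespace Literature.Analysis.FluidPDE

noncomputable section

section Kinetic

variable {d : Type*} [Fintype d] {X : Type*} {N : ℕ}
variable [MeasurableSpace X] [TopologicalSpace X] {G : Geometry d X} {ε : ℝ} {γ : ℝ → Config N d X}

namespace IsHardSphereTrajectory

/-- **A hard-sphere trajectory is Borel measurable in time** (right-continuity and dyadic
approximation from the right). [folklore] -/
theorem measurable [TopologicalSpace.PseudoMetrizableSpace X] [SecondCountableTopology X]
    [BorelSpace X] (h : IsHardSphereTrajectory G ε N γ)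
    (hG : ∀ x : X, Continuous (G.translate x)) : Measurable γ := by
  let u : ℕ → ℝ → Config N d X := fun n s => γ (((⌊s * 2 ^ n⌋ + 1 : ℤ) : ℝ) / 2 ^ n)
  have hu : ∀ n, Measurable (u n) := by
    intro n
    have hg : Measurable fun k : ℤ => γ (((k + 1 : ℤ) : ℝ) / 2 ^ n) := measurable_from_top
    exact hg.comp (HardSphereFlow.measurable_dyadicIndex n)
  refine measurable_of_tendsto_metrizable hu ?_
  rw [tendsto_pi_nhds]
  intro s
  exact (h.tendsto_nhdsGT hG s).comp (HardSphereFlow.tendsto_dyadicUpper s)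

/-- The position of each particle is a measurable (indeed continuous) function of time.
[folklore] -/
theorem measurable_pos [BorelSpace X] (h : IsHardSphereTrajectory G ε N γ) (i : Fin N) :
    Measurable fun t => (γ t i).1 :=
  (h.pos_continuous i).measurable

/-- The velocity of each particle is a measurable function of time (a right-continuous step
function). [folklore] -/
theorem measurable_vel [TopologicalSpace.PseudoMetrizableSpace X] [SecondCountableTopology X]
    [BorelSpace X] (h : IsHardSphereTrajectory G ε N γ)
    (hG : ∀ x : X, Continuous (G.translate x)) (i : Fin N) :
    Measurable fun t => (γ t i).2 :=
  ((measurable_pi_apply i).comp (h.measurable hG)).snd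

end IsHardSphereTrajectory

end Kinetic

/-- On the flat torus: a hard-sphere trajectory is measurable in time. [folklore] -/
theorem IsHardSphereTrajectory.measurable_torus {d : Type*} [Fintype d] {N : ℕ} {ε : ℝ}
    {γ : ℝ → Config N d (UnitAddTorus d)} (h : IsHardSphereTrajectory (Torus.geometry d) ε N γ) :
    Measurable γ :=
  h.measurable fun _ => continuous_const.add Literature.Analysis.FunctionSpaces.Torus.continuous_proj

end

end Literature.Analysis.FluidPDE
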